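import Summits.CriticalPhenomena.PercolationContinuityZ3.Theorems.FK.Transplant.QComparisonCovariance
import Summits.CriticalPhenomena.PercolationContinuityZ3.Theorems.FK.EdgeDensityDerivative
import Mathlib.Analysis.Calculus.Deriv.MeanValue
import HarnessLib

/-!
# Strict comparison in `q`, 4/5: the comparison inequality of (3.25) type along explicit segments (the tree's form
# of Grimmett 2006 Thm. (3.24)) — `φ^B_{G,p₁,q₁}(A) ≤ φ^B_{G,p₂,q₂}(A)` for `2Δq₁(p₁-p₂) ≤ (q₁-q₂)p₂(1-p₁)^Δ`

Registered R71 (cell INBOX l.5302, 2026-08-23); registry row T1m; label T1m-D (coordinator fk-4 g139; adopted by the lead, L45 l.5303 = typer read NO OBJECTION at the statement layer); placement R71 (δ): all seven files of this package live under `Theorems/FK/Transplant/` (own-chain imports re-pointed; statements untouched).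
builds on p205010 (kernel theorem, internal audit signed; external expert review pending). Support file
(`--supports stmt-CriticalPhenomena-4575`, helper) typed by the FRONTIER TRANSPLANT seat `prim-bschramm-fkt-p2`
(`fk-continuity/transplant/`). No definitions, no named facts, no sorries; standard axioms.

HONEST FRAMING (page 1, cell rule). Everything in this file is UNCONDITIONAL finite-graph random-cluster theory
(`q ≥ 1`). It does NOT touch the transplant's theorem of record `ufsc0_of_freeBoundaryHypothesis_r3` (p248245,
« 2 / 0 ☑ »), which stays CONDITIONAL on FH AND TP_FK (open at the same `p` for `q > 1`; ⇔ GRC Conj. (5.103) via K1;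
barrier note `Literature.Barriers.CriticalPhenomena.SamePFreeBoundaryCriteria`); not a binder discharge, not a
re-cut, not `_r4`; `n_open = 2`, BINDER-OWNERS, FO-19 NO-GO unchanged. Purpose of the package
(`QComparisonClusterCount` → `QComparisonSums` → `QComparisonCovariance` → `QComparisonSegment` →
`CriticalPointStrictMono`): the second half of Grimmett 2006 Thm. (5.10) — `q ↦ p_c(q)` is STRICTLY increasing on
`[1, ∞)` for `d ≥ 2` — which `Theorems/FK/CriticalPointBounds.lean` records as "not in this file … needs Thm. (3.24),
not in the tree". The route is NOT the printed one: Grimmett proves Prop. (3.28) by a pair of coupled Markov chains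
([151] = Grimmett 1995); here the left inequality of (3.29) gets a STATIC proof (FKG for the increasing function
`N_W - 2k^B`, FKG on the graph with one edge removed, one-edge finite energy, independence of the edges inside the
wired set) with the explicit constant `α(p, q) = p(1-p)^Δ/(2Δ)`, and Thm. (3.24)'s contour function `γ` is replaced
by explicit admissible segments.

## Contents (namespace `Summit.CriticalPhenomena.PercolationContinuityZ3.Theorems.FK`)

§4c `rcExpect_card_cov_le_clusterCount_cov` (the normalised form of `card_cov_le_clusterCount_cov`).
§5 `rcMeasure_real_eq_sum_mul_div`, **`hasDerivAt_rcWeight_segment`** (logarithmic derivative along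
`r ↦ (p₁ - r(p₁-p₂), q₁ - r(q₁-q₂))`), **`segment_cov_nonneg`** (the derivative of `φ(A)` along an admissible segment
is `≥ 0`), **`rcMeasure_real_le_of_slope`** (the comparison theorem; via the tree's `hasDerivAt_sum_mul_div_sum` and
Mathlib's `monotoneOn_of_hasDerivWithinAt_nonneg`).

## References

* G. Grimmett, *The Random-Cluster Model*, Springer 2006: §3.4 Thm. (3.21)–(3.24), Prop. (3.28) eq. (3.29) and its
  proof (3.36)–(3.39), proof of Thm. (3.24) (3.40)–(3.41), pp. 47–52; Thm. (3.1) eq. (3.3); Thm. 3.8 (FKG); §5.1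
  Thm. (5.5), Thm. (5.10) and its proof (5.14)–(5.15), pp. 99–101. [Grimmett2006]
* G. R. Grimmett, *Comparison and disjoint-occurrence inequalities for random-cluster models*, J. Statist. Phys. 78
  (1995) 1311–1324 (Grimmett's [151]). [Grimmett1995]
-/

noncomputable section

open scoped Classical
open MeasureTheory Finset SimpleGraph

namespace Summit.CriticalPhenomena.PercolationContinuityZ3.Theorems

namespace FK

open Literature.Probability.LatticeModels Literature.Probability.Percolation

/-! ### 4c. The static comparison, normalised -/

section StaticNormalised

variable {V : Type*} [Fintype V] [DecidableEq V] {G : SimpleGraph V} [DecidableRel G.Adj]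

/-- The same inequality for NORMALISED covariances under `φ^B_{G,p,q}` (expectations `rcExpect`):
`((1-p)^{Δ-1}/(2Δ)) · (E[|η| X] - E|η| · E X) ≤ E[k^B] E[X] - E[k^B X]`.
[cite: Grimmett2006, Prop. (3.28) eq. (3.29) (left inequality) p. 49] -/
theorem rcExpect_card_cov_le_clusterCount_cov {p q : ℝ} (hp : p ∈ Set.Ioo (0 : ℝ) 1) (hq : 1 ≤ q)
    (B : Set V) {Δ : ℕ} (hΔ : ∀ x, x ∉ B → G.degree x ≤ Δ) {X : Finset (Sym2 V) → ℝ} (hX0 : 0 ≤ X)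
    (hXm : Monotone X)
    (hXB : ∀ ω : Finset (Sym2 V), ∀ e ∈ G.edgeFinset, (∀ x ∈ e, x ∈ B) → e ∉ ω → X (insert e ω) = X ω) :
    (1 - p) ^ (Δ - 1) / (2 * Δ) *
        (rcExpect G p q B (fun ω => (#ω : ℝ) * X ω) -
          rcExpect G p q B (fun ω => (#ω : ℝ)) * rcExpect G p q B X) ≤
      rcExpect G p q B (fun ω => (clusterCount (↑ω : BondConfig V) B : ℝ)) * rcExpect G p q B X -
        rcExpect G p q B (fun ω => (clusterCount (↑ω : BondConfig V) B : ℝ) * X ω) := by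
  have hpI : p ∈ Set.Icc (0 : ℝ) 1 := ⟨hp.1.le, hp.2.le⟩
  have hq0 : 0 < q := one_pos.trans_le hq
  have hZ := rcPartitionFunction_pos G hpI hq0 B
  have key := card_cov_le_clusterCount_cov (G := G) hp hq B hΔ hX0 hXm hXB
  set Z := rcPartitionFunction G p q B with hZdef
  set S1 := ∑ ω ∈ G.edgeFinset.powerset, rcWeight G p q B ω * ((#ω : ℝ) * X ω) with hS1
  set S2 := ∑ ω ∈ G.edgeFinset.powerset, rcWeight G p q B ω * (#ω : ℝ) with hS2
  set S3 := ∑ ω ∈ G.edgeFinset.powerset, rcWeight G p q B ω * X ω with hS3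
  set S4 := ∑ ω ∈ G.edgeFinset.powerset,
    rcWeight G p q B ω * (clusterCount (↑ω : BondConfig V) B : ℝ) with hS4
  set S5 := ∑ ω ∈ G.edgeFinset.powerset,
    rcWeight G p q B ω * ((clusterCount (↑ω : BondConfig V) B : ℝ) * X ω) with hS5
  have hZeq : ∑ ω ∈ G.edgeFinset.powerset, rcWeight G p q B ω = Z := rfl
  rw [hZeq] at key
  have hE : ∀ F : Finset (Sym2 V) → ℝ, rcExpect G p q B F =
      (∑ ω ∈ G.edgeFinset.powerset, rcWeight G p q B ω * F ω) / Z := by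
    intro F
    rw [rcExpect, sum_div]
    exact sum_congr rfl fun ω _ => by rw [hZdef]; ring
  have h1 : rcExpect G p q B (fun ω => (#ω : ℝ) * X ω) = S1 / Z := hE _
  have h2 : rcExpect G p q B (fun ω => (#ω : ℝ)) = S2 / Z := hE _
  have h3 : rcExpect G p q B X = S3 / Z := hE _
  have h4 : rcExpect G p q B (fun ω => (clusterCount (↑ω : BondConfig V) B : ℝ)) = S4 / Z := hE _
  have h5 : rcExpect G p q B (fun ω => (clusterCount (↑ω : BondConfig V) B : ℝ) * X ω) = S5 / Z := hE _
  rw [h1, h2, h3, h4, h5]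
  have lhs_eq : (1 - p) ^ (Δ - 1) / (2 * Δ) * (S1 / Z - S2 / Z * (S3 / Z)) =
      (1 - p) ^ (Δ - 1) / (2 * Δ) * (Z * S1 - S2 * S3) / (Z * Z) := by
    field_simp
  have rhs_eq : S4 / Z * (S3 / Z) - S5 / Z = (S4 * S3 - Z * S5) / (Z * Z) := by
    field_simp
  rw [lhs_eq, rhs_eq]
  exact div_le_div_of_nonneg_right key (mul_pos hZ hZ).le

end StaticNormalised

/-! ### 5. Comparison along a segment: `φ_{p₁,q₁}(A) ≤ φ_{p₂,q₂}(A)` for `p₂ ≤ p₁`, `q₂ ≤ q₁` (Thm. (3.24) analogue) -/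

section Segment

variable {V : Type*} [Fintype V] [DecidableEq V] (G : SimpleGraph V) [DecidableRel G.Adj]

/-- The probability of an event as a ratio of weight sums: `φ^B_{G,p,q}(A) = (Σ_ω w(ω) 1_A(ω)) / Σ_ω w(ω)`.
[cite: Grimmett2006, §1.2 eq. (1.2)–(1.3)] -/
theorem rcMeasure_real_eq_sum_mul_div {p q : ℝ} (hp : p ∈ Set.Icc (0 : ℝ) 1) (hq : 0 < q) (B : Set V)
    (A : Set (BondConfig V)) :
    (rcMeasure G p q B).real A =
      (∑ ω ∈ G.edgeFinset.powerset,
          rcWeight G p q B ω * if (↑ω : BondConfig V) ∈ A then (1 : ℝ) else 0) /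
        ∑ ω ∈ G.edgeFinset.powerset, rcWeight G p q B ω := by
  rw [rcMeasure_real_eq_rcExpect G hp hq B A, rcExpect, sum_div]
  exact sum_congr rfl fun ω _ => by rw [rcPartitionFunction]; ring

/-- The derivative of the random-cluster weight along the segment `r ↦ (p₁ - r(p₁-p₂), q₁ - r(q₁-q₂))`:
`dw/dr = w · ℓ` with the logarithmic derivative
`ℓ(ω) = -(p₁-p₂)(|ω|/p - |E∖ω|/(1-p)) - (q₁-q₂) k^B(ω)/q` (Grimmett 2006, (2.46)–(2.47) for the `p`-part and
(3.14)/(3.37) for the `q`-part). [cite: Grimmett2006, Thm. (3.13) eq. (3.14) and proof of Thm. (2.43) eq. (2.47)] -/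
theorem hasDerivAt_rcWeight_segment (p₁ p₂ q₁ q₂ : ℝ) (B : Set V) (ω : Finset (Sym2 V)) {s : ℝ}
    (hp0 : p₁ - s * (p₁ - p₂) ≠ 0) (hp1 : p₁ - s * (p₁ - p₂) ≠ 1) (hq0 : q₁ - s * (q₁ - q₂) ≠ 0) :
    HasDerivAt (fun r => rcWeight G (p₁ - r * (p₁ - p₂)) (q₁ - r * (q₁ - q₂)) B ω)
      (rcWeight G (p₁ - s * (p₁ - p₂)) (q₁ - s * (q₁ - q₂)) B ω *
        (-(p₁ - p₂) * ((#ω : ℝ) / (p₁ - s * (p₁ - p₂)) -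
            (#(G.edgeFinset \ ω) : ℝ) / (1 - (p₁ - s * (p₁ - p₂)))) -
          (q₁ - q₂) * ((clusterCount (↑ω : BondConfig V) B : ℝ) / (q₁ - s * (q₁ - q₂))))) s := by
  set a := #ω with ha
  set b := #(G.edgeFinset \ ω) with hb
  set k := clusterCount (↑ω : BondConfig V) B with hk
  have hP : HasDerivAt (fun r : ℝ => p₁ - r * (p₁ - p₂)) (-(p₁ - p₂)) s := by
    simpa using ((hasDerivAt_id s).mul_const (p₁ - p₂)).const_sub p₁
  have hQ : HasDerivAt (fun r : ℝ => q₁ - r * (q₁ - q₂)) (-(q₁ - q₂)) s := by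
    simpa using ((hasDerivAt_id s).mul_const (q₁ - q₂)).const_sub q₁
  have hu := (hasDerivAt_pow_mul_one_sub_pow_mul a b 1 hp0 hp1).comp s hP
  have hu' : HasDerivAt (fun r : ℝ => (p₁ - r * (p₁ - p₂)) ^ a * (1 - (p₁ - r * (p₁ - p₂))) ^ b * (1 : ℝ))
      ((p₁ - s * (p₁ - p₂)) ^ a * (1 - (p₁ - s * (p₁ - p₂))) ^ b * 1 *
          (a / (p₁ - s * (p₁ - p₂)) - b / (1 - (p₁ - s * (p₁ - p₂)))) * (-(p₁ - p₂))) s := hu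
  have hv := (hasDerivAt_pow k (q₁ - s * (q₁ - q₂))).comp s hQ
  have hv' : HasDerivAt (fun r : ℝ => (q₁ - r * (q₁ - q₂)) ^ k)
      ((k : ℝ) * (q₁ - s * (q₁ - q₂)) ^ (k - 1) * (-(q₁ - q₂))) s := hv
  have hfun : (fun r => rcWeight G (p₁ - r * (p₁ - p₂)) (q₁ - r * (q₁ - q₂)) B ω) =
      fun r => ((p₁ - r * (p₁ - p₂)) ^ a * (1 - (p₁ - r * (p₁ - p₂))) ^ b * (1 : ℝ)) *
        (q₁ - r * (q₁ - q₂)) ^ k := by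
    funext r
    simp only [rcWeight, ha, hb, hk, mul_one]
  rw [hfun]
  refine (hu'.fun_mul hv').congr_deriv ?_
  rw [natCast_mul_pow_sub_one hq0]
  simp only [rcWeight, ha, hb, hk]
  ring

variable {G}

/-- **The derivative along the segment is nonnegative** under the slope condition
`2Δ q δp ≤ δq p (1-p)^Δ` (at the current parameters `p ∈ (0,1)`, `q ≥ 1`, increment `δq ≥ 0`): the
covariance of the logarithmic derivative `ℓ = -δp(|η|/p - |E∖η|/(1-p)) - δq k^B/q` with an increasing
`X ≥ 0` not depending on the edges inside `B` is `≥ 0`, by `card_cov_le_clusterCount_cov`.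
[cite: Grimmett2006, proof of Thm. (3.24), eq. (3.40)–(3.41) p. 52] -/
theorem segment_cov_nonneg {p q δp δq : ℝ} (hp : p ∈ Set.Ioo (0 : ℝ) 1) (hq : 1 ≤ q)
    (hδq : 0 ≤ δq) (B : Set V) {Δ : ℕ} (hΔ0 : 0 < Δ) (hΔ : ∀ x, x ∉ B → G.degree x ≤ Δ)
    (hslope : 2 * Δ * q * δp ≤ δq * p * (1 - p) ^ Δ) {X : Finset (Sym2 V) → ℝ} (hX0 : 0 ≤ X)
    (hXm : Monotone X)
    (hXB : ∀ ω : Finset (Sym2 V), ∀ e ∈ G.edgeFinset, (∀ x ∈ e, x ∈ B) → e ∉ ω → X (insert e ω) = X ω) :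
    0 ≤ (∑ ω ∈ G.edgeFinset.powerset, rcWeight G p q B ω *
            ((-δp * ((#ω : ℝ) / p - (#(G.edgeFinset \ ω) : ℝ) / (1 - p)) -
                δq * ((clusterCount (↑ω : BondConfig V) B : ℝ) / q)) * X ω)) /
          (∑ ω ∈ G.edgeFinset.powerset, rcWeight G p q B ω) -
        (∑ ω ∈ G.edgeFinset.powerset, rcWeight G p q B ω *
              (-δp * ((#ω : ℝ) / p - (#(G.edgeFinset \ ω) : ℝ) / (1 - p)) -
                δq * ((clusterCount (↑ω : BondConfig V) B : ℝ) / q))) /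
            (∑ ω ∈ G.edgeFinset.powerset, rcWeight G p q B ω) *
          ((∑ ω ∈ G.edgeFinset.powerset, rcWeight G p q B ω * X ω) /
            ∑ ω ∈ G.edgeFinset.powerset, rcWeight G p q B ω) := by
  have hpI : p ∈ Set.Icc (0 : ℝ) 1 := ⟨hp.1.le, hp.2.le⟩
  have hq0 : 0 < q := one_pos.trans_le hq
  have hp0 : 0 < p := hp.1
  have h1p : 0 < 1 - p := sub_pos.2 hp.2
  have key := card_cov_le_clusterCount_cov (G := G) hp hq B hΔ hX0 hXm hXB
  -- `cov(|η|, X) ≥ 0`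
  have hcard0 := fkg_sum_powerset G hpI hq B (subset_refl G.edgeFinset) (f := fun ω => (#ω : ℝ))
    (g := X) (fun ω => Nat.cast_nonneg (#ω)) hX0
    (fun a b hab => by dsimp only; exact_mod_cast card_le_card hab) hXm
  set E := G.edgeFinset with hE
  set w := rcWeight G p q B with hw
  set Z := ∑ ω ∈ E.powerset, w ω with hZ
  set S1 := ∑ ω ∈ E.powerset, w ω * ((#ω : ℝ) * X ω) with hS1
  set S2 := ∑ ω ∈ E.powerset, w ω * (#ω : ℝ) with hS2
  set S3 := ∑ ω ∈ E.powerset, w ω * X ω with hS3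
  set S4 := ∑ ω ∈ E.powerset, w ω * (clusterCount (↑ω : BondConfig V) B : ℝ) with hS4
  set S5 := ∑ ω ∈ E.powerset, w ω * ((clusterCount (↑ω : BondConfig V) B : ℝ) * X ω) with hS5
  have hZpos : 0 < Z := sum_powerset_rcWeight_pos G hpI hp.2 hq0 B E
  -- the logarithmic derivative is affine in `|ω|` and `k^B(ω)` on the edge sets of `G`
  set α : ℝ := -δp * (1 / p + 1 / (1 - p)) with hα
  set β : ℝ := δp * #E / (1 - p) with hβ
  set γ : ℝ := -δq / q with hγ
  have hℓ : ∀ ω ∈ E.powerset,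
      -δp * ((#ω : ℝ) / p - (#(E \ ω) : ℝ) / (1 - p)) - δq * ((clusterCount (↑ω : BondConfig V) B : ℝ) / q) =
        α * (#ω : ℝ) + β + γ * (clusterCount (↑ω : BondConfig V) B : ℝ) := by
    intro ω hω
    rw [card_sdiff_of_subset (mem_powerset.1 hω), Nat.cast_sub (card_le_card (mem_powerset.1 hω))]
    simp only [hα, hβ, hγ]
    field_simp
    ring
  have e1 : ∑ ω ∈ E.powerset, w ω *
      ((-δp * ((#ω : ℝ) / p - (#(E \ ω) : ℝ) / (1 - p)) -
          δq * ((clusterCount (↑ω : BondConfig V) B : ℝ) / q)) * X ω) = α * S1 + β * S3 + γ * S5 := by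
    rw [hS1, hS3, hS5, mul_sum, mul_sum, mul_sum, ← sum_add_distrib, ← sum_add_distrib]
    refine sum_congr rfl fun ω hω => ?_
    rw [hℓ ω hω]
    ring
  have e2 : ∑ ω ∈ E.powerset, w ω *
      (-δp * ((#ω : ℝ) / p - (#(E \ ω) : ℝ) / (1 - p)) -
          δq * ((clusterCount (↑ω : BondConfig V) B : ℝ) / q)) = α * S2 + β * Z + γ * S4 := by
    rw [hS2, hZ, hS4, mul_sum, mul_sum, mul_sum, ← sum_add_distrib, ← sum_add_distrib]
    refine sum_congr rfl fun ω hω => ?_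
    rw [hℓ ω hω]
    ring
  rw [e1, e2]
  -- the numerator `α cov(|η|,X) + γ cov(k,X) ≥ (α + (δq/q) κ) cov(|η|,X) ≥ 0`
  have hnum : 0 ≤ Z * (α * S1 + β * S3 + γ * S5) - (α * S2 + β * Z + γ * S4) * S3 := by
    have hcov : 0 ≤ Z * S1 - S2 * S3 := by linarith
    have hκ : 0 ≤ α + δq / q * ((1 - p) ^ (Δ - 1) / (2 * Δ)) := by
      have hΔr : (0 : ℝ) < Δ := Nat.cast_pos.2 hΔ0
      have hpow : (1 - p) ^ (Δ - 1) * (1 - p) = (1 - p) ^ Δ := by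
        rw [← pow_succ, Nat.sub_add_cancel hΔ0]
      rw [hα]
      have : -δp * (1 / p + 1 / (1 - p)) + δq / q * ((1 - p) ^ (Δ - 1) / (2 * Δ)) =
          (δq * p * ((1 - p) ^ (Δ - 1) * (1 - p)) - 2 * Δ * q * δp) / (2 * Δ * q * p * (1 - p)) := by
        field_simp
        ring
      rw [this, hpow]
      exact div_nonneg (by linarith) (by positivity)
    have hk : δq / q * ((1 - p) ^ (Δ - 1) / (2 * Δ) * (Z * S1 - S2 * S3)) ≤ γ * (Z * S5 - S4 * S3) := by
      have := mul_le_mul_of_nonneg_left key (div_nonneg hδq hq0.le)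
      rw [hγ]
      have e : -δq / q * (Z * S5 - S4 * S3) = δq / q * (S4 * S3 - Z * S5) := by ring
      rw [e]
      exact this
    have expand : Z * (α * S1 + β * S3 + γ * S5) - (α * S2 + β * Z + γ * S4) * S3 =
        α * (Z * S1 - S2 * S3) + γ * (Z * S5 - S4 * S3) := by ring
    rw [expand]
    calc (0 : ℝ) ≤ (α + δq / q * ((1 - p) ^ (Δ - 1) / (2 * Δ))) * (Z * S1 - S2 * S3) := mul_nonneg hκ hcov
      _ = α * (Z * S1 - S2 * S3) + δq / q * ((1 - p) ^ (Δ - 1) / (2 * Δ) * (Z * S1 - S2 * S3)) := by ring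
      _ ≤ _ := by linarith
  have hform : (α * S1 + β * S3 + γ * S5) / Z - (α * S2 + β * Z + γ * S4) / Z * (S3 / Z) =
      (Z * (α * S1 + β * S3 + γ * S5) - (α * S2 + β * Z + γ * S4) * S3) / (Z * Z) := by
    field_simp
  rw [hform]
  exact div_nonneg hnum (mul_pos hZpos hZpos).le

/-- **Comparison inequality of (3.25) type with an explicit contour (the tree's form of Grimmett 2006,
Thm. (3.24)).** Let `B` be a wired set all of whose outside vertices have degree `≤ Δ` (`Δ ≥ 1`), and let
`A` be an increasing event not depending on the edges with both end points in `B`. If `1 ≤ q₂ ≤ q₁`,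
`0 < p₂ ≤ p₁ < 1` and `2Δ q₁ (p₁ - p₂) ≤ (q₁ - q₂) p₂ (1 - p₁)^Δ`, then `φ^B_{G,p₁,q₁}(A) ≤ φ^B_{G,p₂,q₂}(A)`:
lowering `q` beats lowering `p` along such a segment. (The printed theorem: `φ_{p₁,q₁} ≤_st φ_{p₂,q₂}` if
`γ(p₁,q₁) ≤ γ(p₂,q₂)` for SOME continuous `γ` increasing in `p`, decreasing in `q`; here the admissible direction
is explicit.) Proof: the derivative of `r ↦ φ_{p₁ - r(p₁-p₂), q₁ - r(q₁-q₂)}(A)` is a covariance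
(`hasDerivAt_sum_mul_div_sum`) which is nonnegative by `segment_cov_nonneg`.
[cite: Grimmett2006, Thm. (3.24) eq. (3.25) p. 47] -/
theorem rcMeasure_real_le_of_slope {p₁ p₂ q₁ q₂ : ℝ} (hq₂ : 1 ≤ q₂) (hq : q₂ ≤ q₁) (hp₂ : 0 < p₂)
    (hp : p₂ ≤ p₁) (hp₁ : p₁ < 1) (B : Set V) {Δ : ℕ} (hΔ0 : 0 < Δ) (hΔ : ∀ x, x ∉ B → G.degree x ≤ Δ)
    (hslope : 2 * Δ * q₁ * (p₁ - p₂) ≤ (q₁ - q₂) * p₂ * (1 - p₁) ^ Δ)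
    {A : Set (BondConfig V)} (hA : IsUpperSet A)
    (hAB : ∀ (ω : BondConfig V), ∀ e ∈ G.edgeSet, (∀ x ∈ e, x ∈ B) → (insert e ω ∈ A ↔ ω ∈ A)) :
    (rcMeasure G p₁ q₁ B).real A ≤ (rcMeasure G p₂ q₂ B).real A := by
  set χ : Finset (Sym2 V) → ℝ := fun ω => if (↑ω : BondConfig V) ∈ A then 1 else 0 with hχ
  have hχ0 : 0 ≤ χ := fun ω => by simp only [hχ, Pi.zero_apply]; split_ifs <;> norm_num
  have hχm : Monotone χ := by
    intro a b hab
    simp only [hχ]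
    by_cases ha : (↑a : BondConfig V) ∈ A
    · have hb : (↑b : BondConfig V) ∈ A := hA (Finset.coe_subset.2 hab) ha
      simp [ha, hb]
    · simp only [ha, if_false]; split_ifs <;> norm_num
  have hχB : ∀ ω : Finset (Sym2 V), ∀ e ∈ G.edgeFinset, (∀ x ∈ e, x ∈ B) → e ∉ ω →
      χ (insert e ω) = χ ω := by
    intro ω e he heB _
    simp only [hχ, coe_insert, hAB (↑ω) e (mem_edgeFinset.1 he) heB]
  -- the segment
  set P : ℝ → ℝ := fun r => p₁ - r * (p₁ - p₂) with hP
  set Q : ℝ → ℝ := fun r => q₁ - r * (q₁ - q₂) with hQ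
  set F : ℝ → ℝ := fun r =>
    (∑ ω ∈ G.edgeFinset.powerset, rcWeight G (P r) (Q r) B ω * χ ω) /
      ∑ ω ∈ G.edgeFinset.powerset, rcWeight G (P r) (Q r) B ω with hF
  have hPr : ∀ r ∈ Set.Icc (0 : ℝ) 1, p₂ ≤ P r ∧ P r ≤ p₁ := by
    intro r hr
    simp only [hP]
    constructor <;> nlinarith [hr.1, hr.2, sub_nonneg.2 hp]
  have hQr : ∀ r ∈ Set.Icc (0 : ℝ) 1, q₂ ≤ Q r ∧ Q r ≤ q₁ := by
    intro r hr
    simp only [hQ]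
    constructor <;> nlinarith [hr.1, hr.2, sub_nonneg.2 hq]
  -- derivative of `F` on `[0, 1]`
  set D : ℝ → ℝ := fun r =>
    (∑ ω ∈ G.edgeFinset.powerset, rcWeight G (P r) (Q r) B ω *
          ((-(p₁ - p₂) * ((#ω : ℝ) / (P r) - (#(G.edgeFinset \ ω) : ℝ) / (1 - P r)) -
              (q₁ - q₂) * ((clusterCount (↑ω : BondConfig V) B : ℝ) / (Q r))) * χ ω)) /
        (∑ ω ∈ G.edgeFinset.powerset, rcWeight G (P r) (Q r) B ω) -
      (∑ ω ∈ G.edgeFinset.powerset, rcWeight G (P r) (Q r) B ω *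
            (-(p₁ - p₂) * ((#ω : ℝ) / (P r) - (#(G.edgeFinset \ ω) : ℝ) / (1 - P r)) -
              (q₁ - q₂) * ((clusterCount (↑ω : BondConfig V) B : ℝ) / (Q r)))) /
          (∑ ω ∈ G.edgeFinset.powerset, rcWeight G (P r) (Q r) B ω) *
        ((∑ ω ∈ G.edgeFinset.powerset, rcWeight G (P r) (Q r) B ω * χ ω) /
          ∑ ω ∈ G.edgeFinset.powerset, rcWeight G (P r) (Q r) B ω) with hD
  have hderiv : ∀ r ∈ Set.Icc (0 : ℝ) 1, HasDerivAt F (D r) r := by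
    intro r hr
    have hp0 : P r ≠ 0 := (hp₂.trans_le (hPr r hr).1).ne'
    have hp1 : P r ≠ 1 := ((hPr r hr).2.trans_lt hp₁).ne
    have hq0 : Q r ≠ 0 := (one_pos.trans_le (hq₂.trans (hQr r hr).1)).ne'
    have hZ : ∑ ω ∈ G.edgeFinset.powerset, rcWeight G (P r) (Q r) B ω ≠ 0 :=
      (sum_powerset_rcWeight_pos G ⟨hp₂.le.trans (hPr r hr).1, ((hPr r hr).2.trans hp₁.le)⟩
        ((hPr r hr).2.trans_lt hp₁) (one_pos.trans_le (hq₂.trans (hQr r hr).1)) B _).ne'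
    exact hasDerivAt_sum_mul_div_sum G.edgeFinset.powerset
      (w := fun r ω => rcWeight G (P r) (Q r) B ω) χ
      (fun ω _ => hasDerivAt_rcWeight_segment G p₁ p₂ q₁ q₂ B ω hp0 hp1 hq0) hZ
  -- monotonicity of `F` on `[0, 1]`
  have hmono : MonotoneOn F (Set.Icc 0 1) := by
    refine monotoneOn_of_hasDerivWithinAt_nonneg (f' := D) (convex_Icc 0 1)
      (fun r hr => (hderiv r hr).continuousAt.continuousWithinAt) ?_ ?_
    · intro r hr
      rw [interior_Icc] at hr
      exact ((hderiv r ⟨hr.1.le, hr.2.le⟩).hasDerivWithinAt)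
    · intro r hr
      rw [interior_Icc] at hr
      have hr' : r ∈ Set.Icc (0 : ℝ) 1 := ⟨hr.1.le, hr.2.le⟩
      have hPI : P r ∈ Set.Ioo (0 : ℝ) 1 := ⟨hp₂.trans_le (hPr r hr').1, (hPr r hr').2.trans_lt hp₁⟩
      have hQ1 : 1 ≤ Q r := hq₂.trans (hQr r hr').1
      refine segment_cov_nonneg (G := G) hPI hQ1 (sub_nonneg.2 hq) B hΔ0 hΔ ?_ hχ0 hχm hχB
      -- the slope condition at the current point
      have h1 : (1 - p₁) ^ Δ ≤ (1 - P r) ^ Δ :=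
        pow_le_pow_left₀ (sub_nonneg.2 hp₁.le) (by linarith [(hPr r hr').2]) Δ
      have h2 : 0 ≤ (q₁ - q₂) * p₂ := mul_nonneg (sub_nonneg.2 hq) hp₂.le
      have hΔr : (0 : ℝ) < Δ := Nat.cast_pos.2 hΔ0
      calc 2 * Δ * Q r * (p₁ - p₂) ≤ 2 * Δ * q₁ * (p₁ - p₂) := by
            have h3 := mul_nonneg (mul_nonneg hΔr.le (sub_nonneg.2 (hQr r hr').2)) (sub_nonneg.2 hp)
            nlinarith [h3]
        _ ≤ (q₁ - q₂) * p₂ * (1 - p₁) ^ Δ := hslope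
        _ ≤ (q₁ - q₂) * p₂ * (1 - P r) ^ Δ := mul_le_mul_of_nonneg_left h1 h2
        _ ≤ (q₁ - q₂) * P r * (1 - P r) ^ Δ := by
            have := (hPr r hr').1
            have h3 : 0 ≤ (1 - P r) ^ Δ := pow_nonneg (by linarith [(hPr r hr').2]) Δ
            nlinarith [mul_nonneg (sub_nonneg.2 hq) h3]
  have h01 := hmono (Set.left_mem_Icc.2 zero_le_one) (Set.right_mem_Icc.2 zero_le_one) zero_le_one
  -- identify the end points
  have hP0 : P 0 = p₁ := by simp [hP]
  have hQ0 : Q 0 = q₁ := by simp [hQ]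
  have hP1 : P 1 = p₂ := by simp [hP]
  have hQ1 : Q 1 = q₂ := by simp [hQ]
  have hF0 : F 0 = (rcMeasure G p₁ q₁ B).real A := by
    simp only [hF, hP0, hQ0]
    rw [rcMeasure_real_eq_sum_mul_div G ⟨(hp₂.le.trans hp), hp₁.le⟩ (one_pos.trans_le (hq₂.trans hq)) B A]
  have hF1 : F 1 = (rcMeasure G p₂ q₂ B).real A := by
    simp only [hF, hP1, hQ1]
    rw [rcMeasure_real_eq_sum_mul_div G ⟨hp₂.le, hp.trans hp₁.le⟩ (one_pos.trans_le hq₂) B A]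
  rw [← hF0, ← hF1]
  exact h01

end Segment

end FK

end Summit.CriticalPhenomena.PercolationContinuityZ3.Theorems

end
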